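import Summits.ValiantsHypothesis.ValiantsHypothesis.Theorems.KPlusLogSqLawTropicalBHistogramJumps
import Summits.ValiantsHypothesis.ValiantsHypothesis.Theorems.KPlusLogSqLawTropicalBThinStubIffLongCycles

/-!
# Route «KPlusLogSqLaw», crux `TropicalB` (stmt-ValiantsHypothesis-19771) — `TropicalB` ⟺ FEW CARRIES

HONEST FRAMING.  Helper toward the registered stubs `stub_tropThin` / `stub_tropFat` of `Cruxes/TropicalB/Lines/birth.lean` (crux
`Summit.ValiantsHypothesis.ValiantsHypothesis.Theses.KPlusLogSqLaw.TropicalB`, item stmt-ValiantsHypothesis-19771, route KPlusLogSqLaw; cell `pub-symmetroid`, seat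
val-sym-trop-p1 g25, 2026-08-29; `--supports … --as helper`).  A REFORMULATION (kernel iff) of the OPEN crux; nothing is asserted about `TropicalB`, and nothing
bears on `WeakLifting`, DoorA26 / DoorA34, `MatrixDescartes` (stmt-ValiantsHypothesis-18050) or VP ≠ VNP.

A CARRY of a chain is a step whose class histogram moves by more than one unit replacement (`ℓ¹`-jump `> 2`); its CLASS MASS is the number of columns
whose class changes at it.  By the jump law at `c = 1` (`Jumps.chain_le_jumps`, height `3^K`, NO orbit hypothesis): `n ≤ #J + 3^K·(m + Σ_{k∈J} mass_k)` for
every `J` containing the carries.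

* `carries_arith` — `A ≤ 2^(C X)`, `1 ≤ X`, `m < 2^(⌊log₂m⌋+1)`, `⌊log₂m⌋ ≤ X` ⇒ `A + 3^K(m + A) ≤ 2^((C+6) X)` (`X = K + ⌊log₂m⌋²`, `K ≤ X`).
* **`tropicalB_iff_fewCarries`** — `TropicalB` ⟺ there is `C` such that in every design every UNSIGNED dominant chain has
  `#carries + Σ_{carries} class mass ≤ 2^(C·(K + ⌊log₂ m⌋²))`.  (→) `tropicalB_iff_unsigned` and `mass ≤ m` per step (C ↦ C + 2); (←) the jump law
  (C ↦ C + 6); `K = 0` degenerate.  So the crux bets exactly on the CARRIES of K-class parametric assignment designs — jumps in COUNT space (odometer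
  carries), not exchange-cycle lengths; together with `…FewLongCycles` (p689327): on the LONG carries.
[this cell's law]
-/

set_option linter.dupNamespace false
set_option autoImplicit false

namespace Summit.ValiantsHypothesis.ValiantsHypothesis.Theorems.KPlusLogSqLaw

open Summit.ValiantsHypothesis.ValiantsHypothesis.Theorems.MatrixDescartes.Negative
open Summit.ValiantsHypothesis.ValiantsHypothesis.Theses.KPlusLogSqLaw (TropicalB)
open scoped BigOperators
open Finset

namespace Jumps

/-- arithmetic for the carries iff. [arithmetic] -/
theorem carries_arith (C m K A : ℕ) (hK : 1 ≤ K) (hA : A ≤ 2 ^ (C * (K + Nat.log 2 m ^ 2))) :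
    A + 3 ^ K * (m + A) ≤ 2 ^ ((C + 6) * (K + Nat.log 2 m ^ 2)) := by
  set L := Nat.log 2 m with hL
  set X := K + L ^ 2 with hX
  have hX1 : 1 ≤ X := by omega
  have hLX : L ≤ X := by rw [hX]; nlinarith
  have hm : m ≤ 2 ^ (X + 1) :=
    (Nat.lt_pow_succ_log_self (by norm_num) m).le.trans (Nat.pow_le_pow_right (by norm_num) (by omega))
  have h3 : 3 ^ K ≤ 2 ^ (2 * X) :=
    calc 3 ^ K ≤ 4 ^ K := Nat.pow_le_pow_left (by norm_num) K
      _ = 2 ^ (2 * K) := by rw [pow_mul]; norm_num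
      _ ≤ 2 ^ (2 * X) := Nat.pow_le_pow_right (by norm_num) (by omega)
  have hm' : m ≤ 2 ^ ((C + 1) * X + 1) := hm.trans (Nat.pow_le_pow_right (by norm_num) (by nlinarith))
  have hA' : A ≤ 2 ^ ((C + 1) * X + 1) := hA.trans (Nat.pow_le_pow_right (by norm_num) (by nlinarith))
  have hmA : m + A ≤ 2 ^ ((C + 1) * X + 2) := by
    have : 2 ^ ((C + 1) * X + 2) = 2 ^ ((C + 1) * X + 1) + 2 ^ ((C + 1) * X + 1) := by rw [pow_succ]; ring
    omega
  have hprod : 3 ^ K * (m + A) ≤ 2 ^ ((C + 3) * X + 2) := by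
    calc 3 ^ K * (m + A) ≤ 2 ^ (2 * X) * 2 ^ ((C + 1) * X + 2) := Nat.mul_le_mul h3 hmA
      _ = 2 ^ ((C + 3) * X + 2) := by rw [← pow_add]; ring_nf
  have hA'' : A ≤ 2 ^ ((C + 3) * X + 2) := hA.trans (Nat.pow_le_pow_right (by norm_num) (by nlinarith))
  have hsum : 2 ^ ((C + 3) * X + 2) + 2 ^ ((C + 3) * X + 2) = 2 ^ ((C + 3) * X + 3) := by rw [pow_succ]; ring
  have hfin : 2 ^ ((C + 3) * X + 3) ≤ 2 ^ ((C + 6) * X) := Nat.pow_le_pow_right (by norm_num) (by nlinarith)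
  omega

/-- **`TropicalB` ⟺ few carries** (carry = a step whose class histogram moves by more than one unit replacement; counted with its class mass).
[this cell's law] -/
theorem tropicalB_iff_fewCarries :
    TropicalB ↔ ∃ C : ℕ, ∀ (m K : ℕ) (d : Fin K → ℕ) (v ε : Fin m → Fin m → Fin K → ℤ) (n : ℕ) (θ : Fin (n + 1) → ℤ)
      (p : Fin (n + 1) → Equiv.Perm (Fin m) × (Fin m → Fin K)),
      StrictMono θ → (∀ k, IsDominant d v ε (θ k) (p k)) → (∀ k : Fin n, p k.castSucc ≠ p k.succ) →
      (univ.filter fun k : Fin n =>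
          2 < ∑ l, |((univ.filter fun b => (p k.succ).2 b = l).card : ℤ) - ((univ.filter fun b => (p k.castSucc).2 b = l).card : ℤ)|).card +
        ∑ k ∈ (univ.filter fun k : Fin n =>
          2 < ∑ l, |((univ.filter fun b => (p k.succ).2 b = l).card : ℤ) - ((univ.filter fun b => (p k.castSucc).2 b = l).card : ℤ)|),
          (univ.filter fun b => (p k.castSucc).2 b ≠ (p k.succ).2 b).card ≤ 2 ^ (C * (K + Nat.log 2 m ^ 2)) := by
  classical
  rw [tropicalB_iff_unsigned]
  constructor
  · rintro ⟨C, hC⟩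
    refine ⟨C + 2, fun m K d v ε n θ p hθ hdom hne => ?_⟩
    set J := univ.filter fun k : Fin n =>
        2 < ∑ l, |((univ.filter fun b => (p k.succ).2 b = l).card : ℤ) - ((univ.filter fun b => (p k.castSucc).2 b = l).card : ℤ)| with hJ
    have hn : n ≤ 2 ^ (C * (K + Nat.log 2 m ^ 2)) := hC m K d v ε n θ p hθ hdom hne
    have hJn : J.card ≤ n := (card_le_univ _).trans (by rw [Fintype.card_fin])
    have hmass : ∑ k ∈ J, (univ.filter fun b => (p k.castSucc).2 b ≠ (p k.succ).2 b).card ≤ n * m := by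
      calc ∑ k ∈ J, (univ.filter fun b => (p k.castSucc).2 b ≠ (p k.succ).2 b).card ≤ ∑ _k ∈ J, m :=
            sum_le_sum fun k _ => (card_le_univ _).trans (by rw [Fintype.card_fin])
        _ = J.card * m := by rw [sum_const, smul_eq_mul]
        _ ≤ n * m := Nat.mul_le_mul_right _ hJn
    rcases Nat.eq_zero_or_pos K with hK0 | hK
    · subst hK0
      have hn0 := LocalPattern.eq_zero_of_no_classes p hne
      subst hn0
      have hJ0 : J = ∅ := by ext k; exact k.elim0
      rw [hJ0]; simp
    · set X := K + Nat.log 2 m ^ 2 with hX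
      have hm : m + 1 ≤ 2 ^ (X + 1) :=
        (Nat.lt_pow_succ_log_self (by norm_num) m).trans_le (Nat.pow_le_pow_right (by norm_num) (by rw [hX]; nlinarith))
      calc J.card + ∑ k ∈ J, (univ.filter fun b => (p k.castSucc).2 b ≠ (p k.succ).2 b).card ≤ n + n * m := Nat.add_le_add hJn hmass
        _ = n * (m + 1) := by ring
        _ ≤ 2 ^ (C * X) * 2 ^ (X + 1) := Nat.mul_le_mul hn hm
        _ = 2 ^ (C * X + (X + 1)) := by rw [← pow_add]
        _ ≤ 2 ^ ((C + 2) * X) := Nat.pow_le_pow_right (by norm_num) (by nlinarith)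
  · rintro ⟨C, hC⟩
    refine ⟨C + 6, fun m K d v ε n θ p hθ hdom hne => ?_⟩
    set J := univ.filter fun k : Fin n =>
        2 < ∑ l, |((univ.filter fun b => (p k.succ).2 b = l).card : ℤ) - ((univ.filter fun b => (p k.castSucc).2 b = l).card : ℤ)| with hJ
    set A := J.card + ∑ k ∈ J, (univ.filter fun b => (p k.castSucc).2 b ≠ (p k.succ).2 b).card with hAdef
    have hA : A ≤ 2 ^ (C * (K + Nat.log 2 m ^ 2)) := hC m K d v ε n θ p hθ hdom hne
    rcases Nat.eq_zero_or_pos K with hK0 | hK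
    · subst hK0
      have hn0 := LocalPattern.eq_zero_of_no_classes p hne
      calc n = 0 := hn0
        _ ≤ _ := Nat.zero_le _
    have hjump : ∀ k : Fin n, k ∉ J →
        (∑ l, |((univ.filter fun b => (p k.succ).2 b = l).card : ℤ) - ((univ.filter fun b => (p k.castSucc).2 b = l).card : ℤ)|) ≤ 2 * (1 : ℕ) := by
      intro k hk
      by_contra h
      exact hk (mem_filter.mpr ⟨mem_univ _, by push_cast at h ⊢; omega⟩)
    have hlaw := chain_le_jumps d v ε 1 θ p hθ hdom hne J hjump
    have h31 : (((2 * 1 + 1) ^ K : ℕ) : ℤ) = ((3 ^ K : ℕ) : ℤ) := by norm_num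
    rw [h31] at hlaw
    have harith := carries_arith C m K A hK hA
    -- cast the natural-number arithmetic into `hlaw`'s integer inequality
    have hmassZ : (∑ k ∈ J, ((univ.filter fun b => (p k.castSucc).2 b ≠ (p k.succ).2 b).card : ℤ)) =
        ((∑ k ∈ J, (univ.filter fun b => (p k.castSucc).2 b ≠ (p k.succ).2 b).card : ℕ) : ℤ) := by push_cast; rfl
    rw [hmassZ] at hlaw
    have hAZ : (J.card : ℤ) + ((3 ^ K : ℕ) : ℤ) * ((m : ℤ) + ((∑ k ∈ J, (univ.filter fun b => (p k.castSucc).2 b ≠ (p k.succ).2 b).card : ℕ) : ℤ))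
        ≤ ((A + 3 ^ K * (m + A) : ℕ) : ℤ) := by
      rw [hAdef]; push_cast; nlinarith [Nat.zero_le (3 ^ K), Nat.zero_le J.card,
        Nat.zero_le (∑ k ∈ J, (univ.filter fun b => (p k.castSucc).2 b ≠ (p k.succ).2 b).card)]
    have : (n : ℤ) ≤ ((2 ^ ((C + 6) * (K + Nat.log 2 m ^ 2)) : ℕ) : ℤ) := by
      calc (n : ℤ) ≤ _ := hlaw
        _ ≤ ((A + 3 ^ K * (m + A) : ℕ) : ℤ) := hAZ
        _ ≤ _ := by exact_mod_cast harith
    exact_mod_cast this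

end Jumps

end Summit.ValiantsHypothesis.ValiantsHypothesis.Theorems.KPlusLogSqLaw
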